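import Summits.QuantumFields.BalabanUV.T4Continuum.Support.NE7SliceIterationStepNL
import Summits.QuantumFields.BalabanUV.T4Continuum.Support.NE7SliceIterationContractionArithNL
import Summits.QuantumFields.BalabanUV.T4Continuum.Support.NE7SliceIterationOrbitWeighted
import HarnessLib

/-!
# NE7SliceIterationOrbitWeightedNL — THE (S1) ORBIT THEOREM ON THE NONLINEAR FRAME TARGET, k-UNIFORM TWO-RADIUS WORKING REGION (memo ROAD-G103 §3, (R1′), file (B2)-5):
# `NE7SliceIterationOrbitWeighted` VERBATIM with `Df ↦ D̃f`, `ζ ↦ ζ̃`, step `u ↦ e^{−ζ̃(u)}u`, and ONE new k-free currency `ω ≥ 4C_Γ·M·b₁` (the frame-defect Lipschitz constant times the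
# regime radius in `M`-units) added to `τ` in the contraction line: the step halves `D̃f`, moves the weighted sizes by `≤ 12dM·D̃f`, and the orbit of `u₀` converges sitewise

Cell `pub-balaban`, rung (B)+1 sub-cell t4, lineage `b2b-balaban-t4-ne7-p1`, generation 103 (CRUX PROVER NE7 #1 = OWNER of BINDER row NE7).  Memo `t4/b2b-balaban-t4-ne7-p1-g103/ROAD-G103.md` §3.
WHAT ([folklore]; 0 def, 0 sorry).  **`step_halves_defect_w_nl`**, **`step_sizes_le_w_nl`** (B7's Prop-4 regime for `W` and `U′` at the radius `b₁` and the line `2S + 6M·δmax ≤ M·b₁` displayed); the orbit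
theorem `slice_orbit_w_nl` is the companion file `NE7SliceOrbitNL`.
HONEST FRAMING (page 1): the engine run on OUR state maps; nothing of Bałaban's asserted; NOT (S1)-NL in full (initial state and the slice condition of the limit = NE7b's `NE7SliceLimitNL` are separate
files), NOT NE7; spine 0∕9; finite T⁴ rung (B)+1 — NOT infinite volume, NOT mass gap, NOT BetaPertH, NOT Clay (continuum YM on T⁴ ⇐ BetaPertH ∧ nine spine estimates, 0/9 proved).
-/

set_option autoImplicit false

open scoped BigOperators Matrix.Norms.L2Operator
open NormedSpace Finset Filter Topology

namespace Summit.QuantumFields.BalabanUV.T4Continuum.NE7SliceIterationOrbitWeightedNL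

open Literature.MathematicalPhysics.QuantumFieldTheory.Balaban1983to89
open B7Prop1Explicit B7Prop2Explicit B7Prop3Flat MatrixLog
open T4AveragingDeficitWall (IsUnitaryCfg IsSkewDir SmallField vary curlAt)
open T4AveragingDeficitWallBoundary (IsPeriodicCfg periodBox)
open AveragingDeficitPeriodicCounting (IsPeriodicDir)
open AveragingDeficitTwoLevelPrep (prop1Radius)
open AveragingDeficitMultiLevelPrep (cavgIter LevelSmall tower)
open BlockAveragePushDirGauge (gaugeDir)
open NE3EnergyShapes (IsUnitarySite IsPeriodicSite)
open NE3RightInverseSupLetters (frameC supC)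
open NE3HatInvCurlLetters (supCurlC)
open NE3QbarIterCovLiftPrep (cruxC)
open NE3LinearisedAverageSup (curvSum)
open NE7MeanZeroGaugeSliceW (energyBlockLandauW)
open NE7DefectIterationCauchy (exists_orbit_limit mem_unitary_of_tendsto periodic_of_tendsto)
open SpreadLift (loopRad)
open NE7SliceIterationState (repLog cornerLog sizePair siteSup_le siteSup_nonneg bondSup_le bondSup_nonneg)
open NE7SliceIterationStateNL
open NE7SliceIterationStateFactsNL
open NE7SliceIterationStepNL
open NE7SliceIterationContractionArith (eJ_le step_bound_le_half)
open NE7SliceIterationContractionArithNL (ecM_le_nl eE_le_nl twoKM_cE_le_nl)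
open NE7SliceIterationOrbit (region_sizes)
open NE7SliceIterationOrbitWeighted (weighted_region)

noncomputable section

variable {d : ℕ} {n : Type*} [Fintype n] [DecidableEq n]

section Orbit

variable [Nonempty n] {L : ℕ} (hL : 2 ≤ L) (k : ℕ) {W : Site d → Fin d → (Matrix n n ℂ)ˣ} {x : ℝ} (hWu : IsUnitaryCfg W) (hx : 0 ≤ x) (hs : LevelSmall d L k x)
  (hWx : SmallField W x) (N : ℕ) [NeZero N] (hθ : cruxC d L * (((L : ℝ) ^ (k + 1)) ^ 2 * x) < 1) (U' : Site d → Fin d → (Matrix n n ℂ)ˣ)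
  (hWP : IsPeriodicCfg W ((tower L N (k + 1) : ℕ) : ℤ)) (hU'u : IsUnitaryCfg U') (hU'P : IsPeriodicCfg U' ((tower L N (k + 1) : ℕ) : ℤ))
  -- B7's Prop-4 regime at level `k+1` for `W` and `U′` at the orbit's radius `b₁`, and the frame-defect currency `ω`
  (hd : 1 ≤ d) (κ₀ : Fin d) {α₀ αP x' b₁ ω : ℝ} (hα : 0 < α₀) (hα3 : C0 d * α₀ ≤ 1 / 3) (hα4 : 4 * α₀ ≤ c2' d L) (h52 : pdev W < α₀ * (((L : ℝ) ^ (k + 1))⁻¹) ^ 2)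
  (hsmall : Real.exp (4 * (800 * ((d : ℝ) + 1) ^ 2 * ((d : ℝ) + 4)) * α₀) * (1 + 8 * (131072 * ((d : ℝ) + 1) ^ 2) * ((L : ℝ) ^ (k + 1) * b₁)) ≤ 2)
  (hc₃ : 2 * ((L : ℝ) ^ (k + 1) * b₁) ≤ c3 d L) (h100 : 100 * ((d : ℝ) * L * ((L : ℝ) ^ (k + 1) * b₁)) ≤ 1)
  (hC16 : 16 * (131072 * ((d : ℝ) + 1) ^ 2) * ((L : ℝ) ^ (k + 1) * b₁) ≤ 1) (hsm : 2048 * (d : ℝ) * ((L : ℝ) ^ (k + 1) * b₁) ≤ 1)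
  (hαP : 0 < αP) (hαP3 : C0 d * αP ≤ 1 / 3) (hαP2 : 2 * αP ≤ c2' d L) (hx'0 : 0 ≤ x') (hU'x : SmallField U' x') (hx'P : x' < αP * (((L : ℝ) ^ (k + 1))⁻¹) ^ 2)
  (hω0 : 0 ≤ ω) (hβ : 4 * (56 * ((d : ℝ) * L) ^ 2 + 16 * (131072 * ((d : ℝ) + 1) ^ 2) * ((d : ℝ) * L)) * ((L : ℝ) ^ (k + 1) * b₁) ≤ ω)

/-! ## §1 The step halves the NL defect and moves the weighted sizes little -/

include hWP hU'u hU'P hd κ₀ hα hα3 hα4 h52 hsmall hc₃ h100 hC16 hsm hαP hαP3 hαP2 hx'0 hU'x hx'P hω0 hβ in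
/-- **THE STEP HALVES THE NL DEFECT** on the WEIGHTED region `M·sup‖X(u)‖ ≤ S`, `sup‖h(u)‖ ≤ S`, `D̃f(u) ≤ δmax`, in the k-uniform regime of `NE7SliceIterationOrbitWeighted` with `τ ↦ τ + ω` in the two
lines `τ + ω ≤ 1`, `3·10⁶(1+16K)(1+d)³(1+frameC)(1+supC+supCurlC)·(τ + ω) ≤ 1∕2`, plus `2S + 6M·δmax ≤ M·b₁`. [folklore] -/
theorem step_halves_defect_w_nl
    (hθP : 4 * (d : ℝ) ^ 2 * ((L : ℝ) ^ (k + 1) - 1) ^ 2 * x + 16 * d * loopRad d L ((prop1Radius d L)^[k] x)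
      + 4 * d * ((d : ℝ) - 1) * ((L : ℝ) ^ (k + 1) - 1) ^ 2 * x ≤ 1 / 2)
    {K : ℝ} (hK : 0 ≤ K) (hKε : 16 * K * d * (((L : ℝ) ^ (k + 1)) ^ 2 * x) ≤ 1 / 2)
    (hLet : ∀ Y : Site d → Fin d → Matrix n n ℂ, Y ∈ energyBlockLandauW (d := d) (n := n) L N (k + 1) W →
      ∀ B : ℝ, (∀ (z : Site d) (μ ν : Fin d), μ ≠ ν → ‖curlAt W Y z μ ν‖ ≤ B) → ∀ (y : Site d) (κ : Fin d), ‖Y y κ‖ ≤ K * (L : ℝ) ^ (k + 1) * B)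
    (hε : ((L : ℝ) ^ (k + 1)) ^ 2 * x ≤ 1) (hA : curvSum d L (k + 1) x ≤ 2 / 3 * L) (hθc : cruxC d L * (((L : ℝ) ^ (k + 1)) ^ 2 * x) ≤ 1 / 2)
    {τ S δmax : ℝ} (hτ0 : 0 ≤ τ) (hτ1 : τ + ω ≤ 1) (hτs : 30000 * (d : ℝ) * τ ≤ 1)
    (hC : 3000000 * (1 + 16 * K) * (1 + (d : ℝ)) ^ 3 * (1 + frameC d L) * (1 + supC d L + supCurlC d L) * (τ + ω) ≤ 1 / 2)
    (hS4 : S ≤ 1 / 10000) (hSτ : S ≤ τ)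
    (hδmax : 6 * (d : ℝ) * (L : ℝ) ^ (k + 1) * δmax ≤ 1 / 10000) (hMδ : (L : ℝ) ^ (k + 1) * δmax ≤ τ)
    (h4 : ((L : ℝ) ^ (k + 1)) ^ 2 * x ≤ τ) (h5 : ((L : ℝ) ^ (k + 1)) ^ 2 * x' ≤ τ) (hSb : 2 * S + 6 * ((L : ℝ) ^ (k + 1) * δmax) ≤ (L : ℝ) ^ (k + 1) * b₁)
    {u : Site d → (Matrix n n ℂ)ˣ} (hu : IsUnitarySite u) (huP : IsPeriodicSite u ((tower L N (k + 1) : ℕ) : ℤ))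
    (hgauge : gaugeAct u U' = vary W (repLog W U' u) 1)
    (hcorner : ∀ z, ((u (((L : ℤ) ^ (k + 1)) • z) : (Matrix n n ℂ)ˣ) : Matrix n n ℂ) = exp (cornerLog L k u z))
    (hDf : sliceDefectNL hL k hWu hx hs hWx N hθ U' u ≤ δmax)
    (hΦ1 : (L : ℝ) ^ (k + 1) * (sizePair (L := L) (W := W) k N U' u).1 ≤ S) (hΦ2 : (sizePair (L := L) (W := W) k N U' u).2 ≤ S) :
    sliceDefectNL hL k hWu hx hs hWx N hθ U' (sliceStepNL hL k hWu hx hs hWx N hθ U' u) ≤ sliceDefectNL hL k hWu hx hs hWx N hθ U' u / 2 := by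
  have hM1 : (1 : ℝ) ≤ (L : ℝ) ^ (k + 1) := one_le_pow₀ (by exact_mod_cast (by omega : 1 ≤ L))
  have hd1 : (1 : ℝ) ≤ d := by exact_mod_cast hd
  obtain ⟨hX, hh, h10, -, h20, -⟩ := region_sizes hL k N U' hWP hU'P huP
  obtain ⟨a, hadef⟩ : ∃ a : ℝ, (sizePair (L := L) (W := W) k N U' u).1 = a := ⟨_, rfl⟩
  obtain ⟨b, hbdef⟩ : ∃ b : ℝ, (sizePair (L := L) (W := W) k N U' u).2 = b := ⟨_, rfl⟩
  rw [hadef] at hX h10 hΦ1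
  rw [hbdef] at hh h20 hΦ2
  clear hadef hbdef
  have hMa : (L : ℝ) ^ (k + 1) * a ≤ τ := hΦ1.trans hSτ
  have haS : a ≤ S := (le_mul_of_one_le_left h10 hM1).trans hΦ1
  have ha4 : a ≤ 1 / 10000 := haS.trans hS4
  have hb4 : b ≤ 1 / 10000 := hΦ2.trans hS4
  have hb2 : b ≤ 1 / 100 := hb4.trans (by norm_num)
  have hbτ : b ≤ τ := hΦ2.trans hSτ
  have hX8 : ∀ y κ, ‖repLog W U' u y κ‖ ≤ 1 / 8 := fun y κ => (hX y κ).trans (by linarith only [ha4])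
  have hh8 : ∀ z, ‖cornerLog L k u z‖ ≤ 1 / 8 := fun z => (hh z).trans (by linarith only [hb2])
  have hDf0 : 0 ≤ sliceDefectNL hL k hWu hx hs hWx N hθ U' u := sliceDefectNL_nonneg hL k hWu hx hs hWx N hθ U' u
  obtain ⟨D, hDdef⟩ : ∃ D : ℝ, sliceDefectNL hL k hWu hx hs hWx N hθ U' u = D := ⟨_, rfl⟩
  have hD0 : 0 ≤ D := hDdef ▸ hDf0
  have hDmax : D ≤ δmax := hDdef ▸ hDf
  have hM0 : 0 < (L : ℝ) ^ (k + 1) := by positivity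
  -- the regime radius dominates the state: `a ≤ b₁`, `0 ≤ b₁`
  have hδmax0 : 0 ≤ δmax := hD0.trans hDmax
  have hb₁a : a ≤ b₁ := by
    have h1 : (L : ℝ) ^ (k + 1) * a ≤ (L : ℝ) ^ (k + 1) * b₁ := by linarith only [hΦ1, hSb, mul_nonneg hM0.le hδmax0, h10.trans haS]
    exact le_of_mul_le_mul_left h1 hM0
  have hb₁0 : 0 ≤ b₁ := h10.trans hb₁a
  have hXb : ∀ y κ, ‖repLog W U' u y κ‖ ≤ b₁ := fun y κ => (hX y κ).trans hb₁a
  have hδ : ∀ y μ, ‖gaugeDir W (gaugeFunNL hL k hWu hx hs hWx N hθ U' u) y μ‖ ≤ D := fun y μ =>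
    hDdef ▸ ((norm_gaugeDir_gaugeFunNL_le hL k hWu hx hs hWx N hθ U' hWP hU'u hU'P hu huP hgauge hX8 hcorner hh8 hd hα hα3 hα4 h52 hb₁0 hXb hsmall hc₃ hsm
      hαP hαP3 hαP2 hx'0 hU'x hx'P y μ).trans (delta_le_sliceDefectNL hL k hWu hx hs hWx N hθ U' u))
  have hσ : ∀ y, ‖gaugeFunNL hL k hWu hx hs hWx N hθ U' u y‖ ≤ 6 * d * (L : ℝ) ^ (k + 1) * D := fun y => by
    rw [← hDdef]
    exact norm_gaugeFunNL_le hL k hWu hx hs hWx N hθ U' hWP hU'u hU'P hu huP hgauge hX8 hcorner hh8 hd hα hα3 hα4 h52 hb₁0 hXb hsmall hc₃ hsm hαP hαP3 hαP2 hx'0 hU'x hx'P hθP y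
  have hσ0 : 0 ≤ 6 * (d : ℝ) * (L : ℝ) ^ (k + 1) * D := by positivity
  have hσ4 : 6 * (d : ℝ) * (L : ℝ) ^ (k + 1) * D ≤ 1 / 10000 := (mul_le_mul_of_nonneg_left hDmax (by positivity)).trans hδmax
  have hδ4 : D ≤ 1 / 10000 := by
    have h1 : D ≤ 6 * (d : ℝ) * (L : ℝ) ^ (k + 1) * D := by
      have : (1 : ℝ) ≤ 6 * (d : ℝ) * (L : ℝ) ^ (k + 1) := by nlinarith only [hd1, hM1]
      exact le_mul_of_one_le_left hD0 this
    exact h1.trans hσ4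
  clear hDf hDf0 hΦ2 hS4
  have hfC : 0 ≤ frameC d L := by unfold frameC; positivity
  have hsC : 0 ≤ supC d L := by
    unfold supC NE3RightInverseSupLetters.corrC NE3RightInverseSupLetters.frameC; have := NE3QbarIterCovLiftPrep.liftC_nonneg d; positivity
  have hsCC : 0 ≤ supCurlC d L := by
    unfold supCurlC NE3RightInverseSupLetters.frameC; have := NE3QbarIterCovLiftPrep.liftC_nonneg d; positivity
  have h1θ : 0 < 1 - cruxC d L * (((L : ℝ) ^ (k + 1)) ^ 2 * x) := by linarith only [hθc]
  -- the regime line of the step: `2(a + (D + e_J)) ≤ b₁` (from `M·a ≤ S`, `e_J ≤ D ≤ δmax`, `2S + 6Mδmax ≤ Mb₁`)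
  have hMD : (L : ℝ) ^ (k + 1) * D ≤ τ := (mul_le_mul_of_nonneg_left hDmax hM0.le).trans hMδ
  have heJD : 16384 * D * a + 2048 * (6 * (d : ℝ) * (L : ℝ) ^ (k + 1) * D) * D + 6 * (6 * (d : ℝ) * (L : ℝ) ^ (k + 1) * D) * a ≤ D :=
    (eJ_le hd1 hM1 h10 hD0 hτ0 hMa hMD).trans (by linarith only [mul_le_mul_of_nonneg_right hτs hD0])
  have hsb : 2 * (a + (D + (16384 * D * a + 2048 * (6 * (d : ℝ) * (L : ℝ) ^ (k + 1) * D) * D + 6 * (6 * (d : ℝ) * (L : ℝ) ^ (k + 1) * D) * a))) ≤ b₁ := by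
    have h1 : (L : ℝ) ^ (k + 1) * (2 * (a + (D + D))) ≤ (L : ℝ) ^ (k + 1) * b₁ := by
      linarith only [hΦ1, hSb, mul_le_mul_of_nonneg_left hDmax hM0.le, h10.trans haS, mul_nonneg hM0.le hδmax0]
    have h2 := le_of_mul_le_mul_left h1 hM0
    linarith only [h2, heJD]
  have heJ0 : 0 ≤ 16384 * D * a + 2048 * (6 * (d : ℝ) * (L : ℝ) ^ (k + 1) * D) * D + 6 * (6 * (d : ℝ) * (L : ℝ) ^ (k + 1) * D) * a := by positivity
  obtain ⟨G, hGdef⟩ : ∃ G : ℝ, (56 * ((d : ℝ) * L) ^ 2 + 16 * (131072 * ((d : ℝ) + 1) ^ 2) * ((d : ℝ) * L)) = G := ⟨_, rfl⟩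
  have hG0 : 0 ≤ G := by rw [← hGdef]; positivity
  have hec0 : 0 ≤ 4096 * (6 * (d : ℝ) * (L : ℝ) ^ (k + 1) * D) * b + 4 * (56 * ((d : ℝ) * L) ^ 2 + 16 * (131072 * ((d : ℝ) + 1) ^ 2) * ((d : ℝ) * L)) * ((L : ℝ) ^ (k + 1)) ^ 2 * b₁
      * (D + (16384 * D * a + 2048 * (6 * (d : ℝ) * (L : ℝ) ^ (k + 1) * D) * D + 6 * (6 * (d : ℝ) * (L : ℝ) ^ (k + 1) * D) * a)) := by positivity
  have hφ0 : 0 ≤ (3 + 12 * (d : ℝ)) * (L : ℝ) ^ (k + 1) * (16384 * D * a + 2048 * (6 * (d : ℝ) * (L : ℝ) ^ (k + 1) * D) * D + 6 * (6 * (d : ℝ) * (L : ℝ) ^ (k + 1) * D) * a)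
      + 2 * (4096 * (6 * (d : ℝ) * (L : ℝ) ^ (k + 1) * D) * b + 4 * (56 * ((d : ℝ) * L) ^ 2 + 16 * (131072 * ((d : ℝ) + 1) ^ 2) * ((d : ℝ) * L)) * ((L : ℝ) ^ (k + 1)) ^ 2 * b₁
        * (D + (16384 * D * a + 2048 * (6 * (d : ℝ) * (L : ℝ) ^ (k + 1) * D) * D + 6 * (6 * (d : ℝ) * (L : ℝ) ^ (k + 1) * D) * a))) := by positivity
  have heE0 : 0 ≤ (16384 * D * a + 2048 * (6 * (d : ℝ) * (L : ℝ) ^ (k + 1) * D) * D + 6 * (6 * (d : ℝ) * (L : ℝ) ^ (k + 1) * D) * a)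
      + supC d L / ((L : ℝ) ^ (k + 1) * (1 - cruxC d L * (((L : ℝ) ^ (k + 1)) ^ 2 * x)))
        * ((3 + 12 * (d : ℝ)) * (L : ℝ) ^ (k + 1) * (16384 * D * a + 2048 * (6 * (d : ℝ) * (L : ℝ) ^ (k + 1) * D) * D + 6 * (6 * (d : ℝ) * (L : ℝ) ^ (k + 1) * D) * a)
          + 2 * (4096 * (6 * (d : ℝ) * (L : ℝ) ^ (k + 1) * D) * b + 4 * (56 * ((d : ℝ) * L) ^ 2 + 16 * (131072 * ((d : ℝ) + 1) ^ 2) * ((d : ℝ) * L)) * ((L : ℝ) ^ (k + 1)) ^ 2 * b₁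
            * (D + (16384 * D * a + 2048 * (6 * (d : ℝ) * (L : ℝ) ^ (k + 1) * D) * D + 6 * (6 * (d : ℝ) * (L : ℝ) ^ (k + 1) * D) * a)))) :=
    add_nonneg heJ0 (mul_nonneg (div_nonneg hsC (mul_pos hM0 h1θ).le) hφ0)
  have hexp0 : 0 ≤ Real.exp (4 * (a + D + (16384 * D * a + 2048 * (6 * (d : ℝ) * (L : ℝ) ^ (k + 1) * D) * D + 6 * (6 * (d : ℝ) * (L : ℝ) ^ (k + 1) * D) * a))) - 1 := by
    have := Real.add_one_le_exp (4 * (a + D + (16384 * D * a + 2048 * (6 * (d : ℝ) * (L : ℝ) ^ (k + 1) * D) * D + 6 * (6 * (d : ℝ) * (L : ℝ) ^ (k + 1) * D) * a)))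
    linarith only [this, heJ0, h10, hD0]
  have hcE0 : 0 ≤ (2 * (2 * (6 * (d : ℝ) * (L : ℝ) ^ (k + 1) * D)) * x'
        + 4 * (Real.exp (4 * (a + D + (16384 * D * a + 2048 * (6 * (d : ℝ) * (L : ℝ) ^ (k + 1) * D) * D + 6 * (6 * (d : ℝ) * (L : ℝ) ^ (k + 1) * D) * a))) - 1)
          * (D + (16384 * D * a + 2048 * (6 * (d : ℝ) * (L : ℝ) ^ (k + 1) * D) * D + 6 * (6 * (d : ℝ) * (L : ℝ) ^ (k + 1) * D) * a))
        + 2 * x * (6 * (d : ℝ) * (L : ℝ) ^ (k + 1) * D))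
      + supCurlC d L / (((L : ℝ) ^ (k + 1)) ^ 2 * (1 - cruxC d L * (((L : ℝ) ^ (k + 1)) ^ 2 * x)))
        * ((3 + 12 * (d : ℝ)) * (L : ℝ) ^ (k + 1) * (16384 * D * a + 2048 * (6 * (d : ℝ) * (L : ℝ) ^ (k + 1) * D) * D + 6 * (6 * (d : ℝ) * (L : ℝ) ^ (k + 1) * D) * a)
          + 2 * (4096 * (6 * (d : ℝ) * (L : ℝ) ^ (k + 1) * D) * b + 4 * (56 * ((d : ℝ) * L) ^ 2 + 16 * (131072 * ((d : ℝ) + 1) ^ 2) * ((d : ℝ) * L)) * ((L : ℝ) ^ (k + 1)) ^ 2 * b₁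
            * (D + (16384 * D * a + 2048 * (6 * (d : ℝ) * (L : ℝ) ^ (k + 1) * D) * D + 6 * (6 * (d : ℝ) * (L : ℝ) ^ (k + 1) * D) * a)))) := by
    refine add_nonneg (add_nonneg (add_nonneg (by positivity) (mul_nonneg (mul_nonneg (by norm_num) hexp0) (add_nonneg hD0 heJ0))) (by positivity))
      (mul_nonneg (div_nonneg hsCC (mul_pos (by positivity) h1θ).le) hφ0)
  have hstep := sliceDefectNL_sliceStepNL_le hL k hWu hx hs hWx N hθ U' hWP hU'u hU'P hu huP hgauge hcorner hX ha4 hh hb2 hδ hσ hσ4 h10 hD0 hσ0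
    hd hα hα3 hα4 h52 hsb hsmall hc₃ h100 hC16 hsm hαP hαP3 hαP2 hx'0 hU'x hx'P κ₀ hθP hK hKε hLet hε hA h20 hδ4 heE0 hcE0 le_rfl le_rfl
  rw [hDdef]
  refine hstep.trans ?_
  obtain ⟨M, hMdef⟩ : ∃ M : ℝ, (L : ℝ) ^ (k + 1) = M := ⟨_, rfl⟩
  rw [hMdef] at hM1 hMa hδmax hMδ h4 h5 heE0 hec0 hM0 hMD hβ ⊢
  rw [hGdef] at heE0 hec0 ⊢
  rw [hGdef] at hβ
  have hθcM : cruxC d L * (M ^ 2 * x) ≤ 1 / 2 := by rw [← hMdef]; exact hθc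
  have hτω0 : 0 ≤ τ + ω := by linarith only [hτ0, hω0]
  have hβ' : 4 * G * (M * b₁) ≤ ω := hβ
  -- the floors in the currency `τ + ω`
  have heEb := eE_le_nl (sC := supC d L) (G := G) (b₁ := b₁) (ω := ω) hd1 hM1 hsC h10 h20 hD0 hθcM hτ0 hMa hMD hbτ hτs hG0 hb₁0 hω0 hβ'
  have hcEb := twoKM_cE_le_nl (sCC := supCurlC d L) (G := G) (b₁ := b₁) (ω := ω) hd1 hM1 hK hsCC h10 h20 hD0 hθcM hτ0 hMa hMD hbτ h4 h5 hτs hG0 hb₁0 hω0 hβ'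
  have hecb := ecM_le_nl (G := G) (b₁ := b₁) (ω := ω) hd1 hM1 h10 hD0 hτ0 hMa hMD hbτ hτs hω0 hβ' (η := b)
  have h4' : M ^ 2 * x ≤ τ + ω := by linarith only [h4, hω0]
  exact step_bound_le_half hd1 hM1 hK hfC hsC hsCC hD0 hx hτω0 hτ1 h4' heE0 hec0 heEb hcEb hecb hC


include hWP hU'u hU'P hd hα hα3 hα4 h52 hsmall hc₃ hsm hαP hαP3 hαP2 hx'0 hU'x hx'P in
/-- **THE STEP MOVES THE WEIGHTED SIZES BY `≤ 12dM·D̃f(u)`** on the weighted region (`S ≤ 10⁻⁴`, `S ≤ τ`, `6dM·δmax ≤ 10⁻⁴`, `30000dτ ≤ 1`, `2S + 6Mδmax ≤ Mb₁`). [folklore] -/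
theorem step_sizes_le_w_nl
    (hθP : 4 * (d : ℝ) ^ 2 * ((L : ℝ) ^ (k + 1) - 1) ^ 2 * x + 16 * d * loopRad d L ((prop1Radius d L)^[k] x)
      + 4 * d * ((d : ℝ) - 1) * ((L : ℝ) ^ (k + 1) - 1) ^ 2 * x ≤ 1 / 2)
    {τ S δmax : ℝ} (hτs : 30000 * (d : ℝ) * τ ≤ 1)
    (hS4 : S ≤ 1 / 10000) (hSτ : S ≤ τ)
    (hδmax : 6 * (d : ℝ) * (L : ℝ) ^ (k + 1) * δmax ≤ 1 / 10000) (hSb : 2 * S + 6 * ((L : ℝ) ^ (k + 1) * δmax) ≤ (L : ℝ) ^ (k + 1) * b₁)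
    {u : Site d → (Matrix n n ℂ)ˣ} (hu : IsUnitarySite u) (huP : IsPeriodicSite u ((tower L N (k + 1) : ℕ) : ℤ))
    (hgauge : gaugeAct u U' = vary W (repLog W U' u) 1)
    (hcorner : ∀ z, ((u (((L : ℤ) ^ (k + 1)) • z) : (Matrix n n ℂ)ˣ) : Matrix n n ℂ) = exp (cornerLog L k u z))
    (hDf : sliceDefectNL hL k hWu hx hs hWx N hθ U' u ≤ δmax)
    (hΦ1 : (L : ℝ) ^ (k + 1) * (sizePair (L := L) (W := W) k N U' u).1 ≤ S) (hΦ2 : (sizePair (L := L) (W := W) k N U' u).2 ≤ S) :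
    ‖((L : ℝ) ^ (k + 1) * (sizePair (L := L) (W := W) k N U' (sliceStepNL hL k hWu hx hs hWx N hθ U' u)).1,
        (sizePair (L := L) (W := W) k N U' (sliceStepNL hL k hWu hx hs hWx N hθ U' u)).2)‖
      ≤ ‖((L : ℝ) ^ (k + 1) * (sizePair (L := L) (W := W) k N U' u).1, (sizePair (L := L) (W := W) k N U' u).2)‖
        + 12 * d * (L : ℝ) ^ (k + 1) * sliceDefectNL hL k hWu hx hs hWx N hθ U' u := by
  haveI : NeZero L := ⟨by omega⟩
  have hP1 : 1 ≤ tower L N (k + 1) := Nat.one_le_iff_ne_zero.mpr (NeZero.ne _)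
  have hN1 : 1 ≤ N := Nat.one_le_iff_ne_zero.mpr (NeZero.ne _)
  have hM1 : (1 : ℝ) ≤ (L : ℝ) ^ (k + 1) := one_le_pow₀ (by exact_mod_cast (by omega : 1 ≤ L))
  have hd1 : (1 : ℝ) ≤ d := by exact_mod_cast hd
  obtain ⟨hX, hh, h10, -, h20, -⟩ := region_sizes hL k N U' hWP hU'P huP
  obtain ⟨a, hadef⟩ : ∃ a : ℝ, (sizePair (L := L) (W := W) k N U' u).1 = a := ⟨_, rfl⟩
  obtain ⟨b, hbdef⟩ : ∃ b : ℝ, (sizePair (L := L) (W := W) k N U' u).2 = b := ⟨_, rfl⟩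
  rw [hadef] at hX h10 hΦ1
  rw [hbdef] at hh h20 hΦ2
  rw [hadef, hbdef]
  have hMa : (L : ℝ) ^ (k + 1) * a ≤ τ := hΦ1.trans hSτ
  have haS : a ≤ S := (le_mul_of_one_le_left h10 hM1).trans hΦ1
  have ha4 : a ≤ 1 / 10000 := haS.trans hS4
  have hb4 : b ≤ 1 / 10000 := hΦ2.trans hS4
  have hb2 : b ≤ 1 / 100 := hb4.trans (by norm_num)
  have hX8 : ∀ y κ, ‖repLog W U' u y κ‖ ≤ 1 / 8 := fun y κ => (hX y κ).trans (by linarith only [ha4])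
  have hh8 : ∀ z, ‖cornerLog L k u z‖ ≤ 1 / 8 := fun z => (hh z).trans (by linarith only [hb2])
  have hDf0 : 0 ≤ sliceDefectNL hL k hWu hx hs hWx N hθ U' u := sliceDefectNL_nonneg hL k hWu hx hs hWx N hθ U' u
  obtain ⟨D, hDdef⟩ : ∃ D : ℝ, sliceDefectNL hL k hWu hx hs hWx N hθ U' u = D := ⟨_, rfl⟩
  have hD0 : 0 ≤ D := hDdef ▸ hDf0
  have hDmax : D ≤ δmax := hDdef ▸ hDf
  have hM0 : 0 < (L : ℝ) ^ (k + 1) := by positivity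
  have hδmax0 : 0 ≤ δmax := hD0.trans hDmax
  have hb₁a : a ≤ b₁ := by
    have h1 : (L : ℝ) ^ (k + 1) * a ≤ (L : ℝ) ^ (k + 1) * b₁ := by linarith only [hΦ1, hSb, mul_nonneg hM0.le hδmax0, h10.trans haS]
    exact le_of_mul_le_mul_left h1 hM0
  have hb₁0 : 0 ≤ b₁ := h10.trans hb₁a
  have hXb : ∀ y κ, ‖repLog W U' u y κ‖ ≤ b₁ := fun y κ => (hX y κ).trans hb₁a
  clear hDf hDf0
  have hδ : ∀ y μ, ‖gaugeDir W (gaugeFunNL hL k hWu hx hs hWx N hθ U' u) y μ‖ ≤ D := fun y μ =>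
    hDdef ▸ ((norm_gaugeDir_gaugeFunNL_le hL k hWu hx hs hWx N hθ U' hWP hU'u hU'P hu huP hgauge hX8 hcorner hh8 hd hα hα3 hα4 h52 hb₁0 hXb hsmall hc₃ hsm hαP hαP3 hαP2 hx'0 hU'x hx'P y μ).trans
      (delta_le_sliceDefectNL hL k hWu hx hs hWx N hθ U' u))
  have hσ : ∀ y, ‖gaugeFunNL hL k hWu hx hs hWx N hθ U' u y‖ ≤ 6 * d * (L : ℝ) ^ (k + 1) * D := fun y => by
    rw [← hDdef]; exact norm_gaugeFunNL_le hL k hWu hx hs hWx N hθ U' hWP hU'u hU'P hu huP hgauge hX8 hcorner hh8 hd hα hα3 hα4 h52 hb₁0 hXb hsmall hc₃ hsm hαP hαP3 hαP2 hx'0 hU'x hx'P hθP y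
  have hσ0 : 0 ≤ 6 * (d : ℝ) * (L : ℝ) ^ (k + 1) * D := by positivity
  have hσ4 : 6 * (d : ℝ) * (L : ℝ) ^ (k + 1) * D ≤ 1 / 10000 := (mul_le_mul_of_nonneg_left hDmax (by positivity)).trans hδmax
  have hX1 := norm_repLog_sliceStepNL_le hL k hWu hx hs hWx N hθ U' hgauge hX ha4 hδ hσ hσ4
  have hh1 := norm_cornerLog_sliceStepNL_le hL k hWu hx hs hWx N hθ U' hcorner hh hb2 hσ hσ4
  clear hδ hXb hb₁0 hb₁a
  obtain ⟨M, hMdef⟩ : ∃ M : ℝ, (L : ℝ) ^ (k + 1) = M := ⟨_, rfl⟩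
  rw [hMdef] at hM1 hMa hσ hσ0 hσ4 hX1 hh1 hδmax hΦ1 hM0 ⊢
  have heJ : 16384 * D * a + 2048 * (6 * (d : ℝ) * M * D) * D + 6 * (6 * (d : ℝ) * M * D) * a ≤ 2 * D := by
    have t1 : 16384 * D * a ≤ 16384 * D * (1 / 10000) := mul_le_mul_of_nonneg_left ha4 (by positivity)
    have t2 : (6 * (d : ℝ) * M * D) * D ≤ (1 / 10000) * D := mul_le_mul_of_nonneg_right hσ4 hD0
    have t3 : 6 * (6 * (d : ℝ) * M * D) * a = 36 * (d : ℝ) * (M * a) * D := by ring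
    have t4 : 36 * (d : ℝ) * (M * a) * D ≤ 36 * (d : ℝ) * τ * D := by
      have := mul_le_mul_of_nonneg_left hMa (by positivity : (0:ℝ) ≤ 36 * (d : ℝ) * D); linarith only [this]
    have t5 : (30000 * (d : ℝ) * τ) * D ≤ 1 * D := mul_le_mul_of_nonneg_right hτs hD0
    linarith only [t1, t2, t3, t4, t5, hD0]
  have hcomp1 : ∀ y κ, ‖repLog W U' (sliceStepNL hL k hWu hx hs hWx N hθ U' u) y κ‖ ≤ a + 3 * D := fun y κ => by
    have := hX1 y κ
    linarith only [this, heJ, hD0]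
  have hcomp2 : ∀ z, ‖cornerLog L k (sliceStepNL hL k hWu hx hs hWx N hθ U' u) z‖ ≤ b + 12 * d * M * D := fun z => by
    have := hh1 z
    have t : 4096 * (6 * (d : ℝ) * M * D) * b ≤ (6 * (d : ℝ) * M * D) * (4096 * (1 / 10000)) := by
      have := mul_le_mul_of_nonneg_left hb4 hσ0; linarith only [this]
    linarith only [this, t, hσ0]
  have hfst : (sizePair (L := L) (W := W) k N U' (sliceStepNL hL k hWu hx hs hWx N hθ U' u)).1 ≤ a + 3 * D :=
    bondSup_le hP1 (by positivity) hcomp1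
  have hsnd : (sizePair (L := L) (W := W) k N U' (sliceStepNL hL k hWu hx hs hWx N hθ U' u)).2 ≤ b + 12 * d * M * D :=
    siteSup_le hN1 hcomp2
  have hfst0 : 0 ≤ (sizePair (L := L) (W := W) k N U' (sliceStepNL hL k hWu hx hs hWx N hθ U' u)).1 := bondSup_nonneg fun y μ => norm_nonneg _
  have hsnd0 : 0 ≤ (sizePair (L := L) (W := W) k N U' (sliceStepNL hL k hWu hx hs hWx N hθ U' u)).2 := siteSup_nonneg fun z => norm_nonneg _
  obtain ⟨a1, ha1def⟩ : ∃ a1 : ℝ, (sizePair (L := L) (W := W) k N U' (sliceStepNL hL k hWu hx hs hWx N hθ U' u)).1 = a1 := ⟨_, rfl⟩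
  obtain ⟨b1, hb1def⟩ : ∃ b1 : ℝ, (sizePair (L := L) (W := W) k N U' (sliceStepNL hL k hWu hx hs hWx N hθ U' u)).2 = b1 := ⟨_, rfl⟩
  rw [ha1def] at hfst hfst0
  rw [hb1def] at hsnd hsnd0
  rw [ha1def, hb1def, hDdef]
  have hMfst : M * a1 ≤ M * a + 3 * M * D := by
    have := mul_le_mul_of_nonneg_left hfst hM0.le; linarith only [this]
  have hdM1 : (1 : ℝ) ≤ (d : ℝ) := hd1
  have h3M : 3 * M * D ≤ 12 * d * M * D := by nlinarith only [hdM1, hM0.le, hD0, mul_nonneg hM0.le hD0]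
  have hMa0 : 0 ≤ M * a := mul_nonneg hM0.le h10
  have hMa10 : 0 ≤ M * a1 := mul_nonneg hM0.le hfst0
  rw [Prod.norm_def, Prod.norm_def, Real.norm_of_nonneg hMa10, Real.norm_of_nonneg hsnd0, Real.norm_of_nonneg hMa0, Real.norm_of_nonneg h20]
  exact max_le (by linarith only [le_max_left (M * a) b, hMfst, h3M]) (by linarith only [le_max_right (M * a) b, hsnd])


end Orbit

end

end Summit.QuantumFields.BalabanUV.T4Continuum.NE7SliceIterationOrbitWeightedNL
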